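import Mathlib.Logic.Equiv.Basic
import Literature.Combinatorics.SimpleGraph.ColourRefinementCoarsest
import Literature.Combinatorics.SimpleGraph.ColouringSections

/-!
# Locality of colour refinement across a section (per-path reduction for `NoHiddenOrder`, stmt-PneNP-14781)

Route `PneNP/SymmetryBudget`, dichotomy `NoHiddenOrder` (stmt-PneNP-14781) / `WindowBarrier` (stmt-PneNP-2145); memo
`PER-PATH.md`, Lemma 2 ("locality: internal = global refinement; the outside is untouched"), companion of
`SymmetryBudgetNoHiddenOrderPerPathNoCrossing.lean` (Lemma 1). Setting: `ρ` an equitable colouring of `G`, `K` a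
section of `ρ` (Laubner 2011, Def. 3.3.1), `μ : V → ℕ` a colouring finer than `ρ` that makes no new distinctions
outside `K` (the points individualised lie in `K`), and `ρ* := ocrIter G μ t` (`|V| ≤ t + 1`) the coarsest equitable
refinement of `μ` (colour refinement; `ColourRefinementCoarsest.lean`). Proved:

* `isSection_of_finer` — a section of `ρ` is a section of every refinement of `ρ`;
* `count_eq_inside` — an equitable colouring with section `K` is equitable INSIDE `K` (and inside `Kᶜ`):
  the outside contributions to the neighbour counts are homogeneous; `isEquitable_induce_iff` bridges this count
  form to `IsEquitable (G.induce K)`;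
* `isEquitable_glue` — gluing a colouring equitable inside `K` with one equitable inside `Kᶜ` gives an equitable
  colouring of `G` as soon as the cross blocks are homogeneous;
* **`ocrIter_eq_outside`** (the outside is untouched): on `Kᶜ` the classes of `ρ*` are the classes of `ρ`;
* **`ocrIter_restrict_iff`** (internal = global): on `K` the classes of `ρ*` are the classes of colour refinement run
  on the induced subgraph `G.induce K` from `μ|_K`.

As the proofs show, Lemma 2 of the memo needs no "union of cells" hypothesis; that property (Lemma 1) is used only
for the switching-graph separation in Theorem 1(a) / Corollary 3 there. No definitions; Mathlib + tree vocabulary.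
-/

-- `Summit.PneNP.PneNP.…` duplicates `PneNP` BY DESIGN (single-problem summit, D-0017 layout).
set_option linter.dupNamespace false

namespace Summit.PneNP.PneNP.Theorems

namespace PerPath

open Finset Literature.Combinatorics.SimpleGraph

variable {V : Type*} [Fintype V]
variable {G : SimpleGraph V} [DecidableRel G.Adj]

omit [Fintype V] [DecidableRel G.Adj] in
/-- A section of `ρ` is a section of every colouring finer than `ρ` (the defining constraint only weakens). -/
theorem isSection_of_finer {κ κ' : Type*} {ρ : V → κ} {ρ' : V → κ'} {H : Set V} (hH : IsSection G ρ H)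
    (hfin : ∀ u v, ρ' u = ρ' v → ρ u = ρ v) : IsSection G ρ' H :=
  fun _ _ _ _ hu hv => hH (hfin _ _ hu) (hfin _ _ hv)

/-- Counting with a finset. -/
private theorem natCard_subtype (p : V → Prop) [DecidablePred p] :
    Nat.card {w : V // p w} = (univ.filter p).card := by
  rw [Nat.card_eq_fintype_card, Fintype.card_subtype]

/-- **An equitable colouring with section `K` is equitable inside `K`**: for `u, v ∈ K` of the same colour and
every colour `y`, `u` and `v` have equally many neighbours of colour `y` INSIDE `K` — the neighbours outside `K` of
colour `y` number `|Kᶜ ∩ ρ⁻¹ y|` or `0`, the same for `u` and `v`, by the section property. (Apply to `Kᶜ`,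
`IsSection.compl`, for the outside.) -/
theorem count_eq_inside {κ : Type*} [DecidableEq κ] {ρ : V → κ} (hρ : IsEquitable G ρ) {K : Set V}
    [DecidablePred (· ∈ K)] (hK : IsSection G ρ K) {u v : V} (hu : u ∈ K) (hv : v ∈ K) (huv : ρ u = ρ v) (y : κ) :
    (univ.filter fun w => w ∈ K ∧ G.Adj u w ∧ ρ w = y).card =
      (univ.filter fun w => w ∈ K ∧ G.Adj v w ∧ ρ w = y).card := by
  -- total counts agree
  have htot : (univ.filter fun w => G.Adj u w ∧ ρ w = y).card = (univ.filter fun w => G.Adj v w ∧ ρ w = y).card := by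
    rw [← natCard_subtype, ← natCard_subtype]; exact hρ u v huv y
  -- split the totals along `K`
  have hsplit : ∀ x : V, (univ.filter fun w => G.Adj x w ∧ ρ w = y).card =
      (univ.filter fun w => w ∈ K ∧ G.Adj x w ∧ ρ w = y).card +
        (univ.filter fun w => w ∉ K ∧ G.Adj x w ∧ ρ w = y).card := by
    intro x
    rw [← card_filter_add_card_filter_not (p := fun w => w ∈ K), filter_filter, filter_filter]
    congr 2 <;> ext w <;> simp only [mem_filter, mem_univ, true_and] <;> tauto
  -- the outside parts agree: all of `Kᶜ ∩ ρ⁻¹ y` or nothing, for `u` and `v` alike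
  have hout : (univ.filter fun w => w ∉ K ∧ G.Adj u w ∧ ρ w = y).card =
      (univ.filter fun w => w ∉ K ∧ G.Adj v w ∧ ρ w = y).card := by
    congr 1
    ext w
    simp only [mem_filter, mem_univ, true_and]
    constructor
    · rintro ⟨hwK, hadj, hwy⟩
      exact ⟨hwK, (hK huv (rfl : ρ w = ρ w) (iff_of_true hu hv) Iff.rfl fun h => hwK (h.1 hu)).1 hadj, hwy⟩
    · rintro ⟨hwK, hadj, hwy⟩
      exact ⟨hwK, (hK huv.symm (rfl : ρ w = ρ w) (iff_of_true hv hu) Iff.rfl fun h => hwK (h.1 hv)).1 hadj, hwy⟩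
  have h1 := hsplit u
  have h2 := hsplit v
  omega

/-- **Bridge to the induced subgraph**: a colouring is equitable on `G.induce K` iff it is equitable inside `K` in
the counting form of `count_eq_inside`. -/
theorem isEquitable_induce_iff {κ : Type*} [DecidableEq κ] (K : Set V) [DecidablePred (· ∈ K)] (c : V → κ) :
    IsEquitable (G.induce K) (fun x : K => c x) ↔
      ∀ u v : V, u ∈ K → v ∈ K → c u = c v → ∀ y : κ,
        (univ.filter fun w => w ∈ K ∧ G.Adj u w ∧ c w = y).card =
          (univ.filter fun w => w ∈ K ∧ G.Adj v w ∧ c w = y).card := by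
  -- the count on the subtype equals the count inside `K`
  have hcount : ∀ (x : K) (y : κ),
      Nat.card {w : K // (G.induce K).Adj x w ∧ c w = y} =
        (univ.filter fun w : V => w ∈ K ∧ G.Adj x w ∧ c w = y).card := by
    intro x y
    rw [← natCard_subtype]
    exact Nat.card_congr (Equiv.subtypeSubtypeEquivSubtypeInter (fun w => w ∈ K) fun w => G.Adj x w ∧ c w = y)
  constructor
  · intro h u v hu hv huv y
    have := h ⟨u, hu⟩ ⟨v, hv⟩ huv y
    rwa [hcount, hcount] at this
  · intro h u v huv y
    rw [hcount, hcount]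
    exact h u v u.2 v.2 huv y

/-- **Gluing**: if `τ` is equitable inside `K`, `σ` is equitable inside `Kᶜ`, and the cross blocks between a
`τ`-class in `K` and a `σ`-class in `Kᶜ` are homogeneous, then the glued colouring (`τ` on `K`, `σ` on `Kᶜ`, kept
apart by `Sum`) is equitable on `G`. -/
theorem isEquitable_glue {κ₁ κ₂ : Type*} [DecidableEq κ₁] [DecidableEq κ₂] (K : Set V) [DecidablePred (· ∈ K)]
    {τ : V → κ₁} {σ : V → κ₂}
    (hτ : ∀ u v : V, u ∈ K → v ∈ K → τ u = τ v → ∀ y : κ₁,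
      (univ.filter fun w => w ∈ K ∧ G.Adj u w ∧ τ w = y).card =
        (univ.filter fun w => w ∈ K ∧ G.Adj v w ∧ τ w = y).card)
    (hσ : ∀ u v : V, u ∉ K → v ∉ K → σ u = σ v → ∀ y : κ₂,
      (univ.filter fun w => w ∉ K ∧ G.Adj u w ∧ σ w = y).card =
        (univ.filter fun w => w ∉ K ∧ G.Adj v w ∧ σ w = y).card)
    (hcross : ∀ u u' w w' : V, u ∈ K → u' ∈ K → w ∉ K → w' ∉ K → τ u = τ u' → σ w = σ w' →
      (G.Adj u w ↔ G.Adj u' w')) :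
    IsEquitable G (fun x => if x ∈ K then (Sum.inl (τ x) : κ₁ ⊕ κ₂) else Sum.inr (σ x)) := by
  intro u v huv y
  rw [natCard_subtype, natCard_subtype]
  by_cases hu : u ∈ K
  · have hv : v ∈ K := by
      by_contra hv; simp [hu, hv] at huv
    have huv' : τ u = τ v := by simpa [hu, hv] using huv
    rcases y with y | y
    · -- neighbours of glued colour `inl y`: inside `K`, `τ`-colour `y`
      have hre : ∀ x : V, (univ.filter fun w => G.Adj x w ∧
          (if w ∈ K then (Sum.inl (τ w) : κ₁ ⊕ κ₂) else Sum.inr (σ w)) = Sum.inl y) =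
          univ.filter fun w => w ∈ K ∧ G.Adj x w ∧ τ w = y := by
        intro x; ext w
        by_cases hw : w ∈ K <;> simp [hw]
      rw [hre, hre]
      exact hτ u v hu hv huv' y
    · -- neighbours of glued colour `inr y`: outside `K`, `σ`-colour `y`; homogeneous towards `u`, `v`
      have hre : ∀ x : V, (univ.filter fun w => G.Adj x w ∧
          (if w ∈ K then (Sum.inl (τ w) : κ₁ ⊕ κ₂) else Sum.inr (σ w)) = Sum.inr y) =
          univ.filter fun w => w ∉ K ∧ G.Adj x w ∧ σ w = y := by
        intro x; ext w
        by_cases hw : w ∈ K <;> simp [hw]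
      rw [hre, hre]
      congr 1; ext w
      simp only [mem_filter, mem_univ, true_and]
      constructor
      · rintro ⟨hwK, hadj, hwy⟩; exact ⟨hwK, (hcross u v w w hu hv hwK hwK huv' rfl).1 hadj, hwy⟩
      · rintro ⟨hwK, hadj, hwy⟩; exact ⟨hwK, (hcross u v w w hu hv hwK hwK huv' rfl).2 hadj, hwy⟩
  · have hv : v ∉ K := by
      intro hv; simp [hu, hv] at huv
    have huv' : σ u = σ v := by simpa [hu, hv] using huv
    rcases y with y | y
    · -- inside neighbours of outside vertices: homogeneous
      have hre : ∀ x : V, (univ.filter fun w => G.Adj x w ∧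
          (if w ∈ K then (Sum.inl (τ w) : κ₁ ⊕ κ₂) else Sum.inr (σ w)) = Sum.inl y) =
          univ.filter fun w => w ∈ K ∧ G.Adj x w ∧ τ w = y := by
        intro x; ext w
        by_cases hw : w ∈ K <;> simp [hw]
      rw [hre, hre]
      congr 1; ext w
      simp only [mem_filter, mem_univ, true_and]
      constructor
      · rintro ⟨hwK, hadj, hwy⟩
        exact ⟨hwK, G.adj_symm ((hcross w w u v hwK hwK hu hv rfl huv').1 (G.adj_symm hadj)), hwy⟩
      · rintro ⟨hwK, hadj, hwy⟩
        exact ⟨hwK, G.adj_symm ((hcross w w u v hwK hwK hu hv rfl huv').2 (G.adj_symm hadj)), hwy⟩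
    · have hre : ∀ x : V, (univ.filter fun w => G.Adj x w ∧
          (if w ∈ K then (Sum.inl (τ w) : κ₁ ⊕ κ₂) else Sum.inr (σ w)) = Sum.inr y) =
          univ.filter fun w => w ∉ K ∧ G.Adj x w ∧ σ w = y := by
        intro x; ext w
        by_cases hw : w ∈ K <;> simp [hw]
      rw [hre, hre]
      exact hσ u v hu hv huv' y

section Locality

variable {κ : Type*} [DecidableEq κ] {ρ : V → κ} {K : Set V} [DecidablePred (· ∈ K)] {μ : V → ℕ} {t : ℕ}

/-- **Locality, outside part** (PER-PATH.md Lemma 2): let `ρ` be equitable, `K` a section of `ρ`, `μ` finer than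
`ρ` with no new distinctions outside `K`, and `|V| ≤ t + 1`. Then outside `K` the coarsest equitable refinement
`ocrIter G μ t` of `μ` induces the same partition as `ρ`: refining inside a section block never splits a cell
outside the block. -/
theorem ocrIter_eq_outside (hρ : IsEquitable G ρ) (hK : IsSection G ρ K) (hμρ : ∀ u v, μ u = μ v → ρ u = ρ v)
    (hout : ∀ u v, u ∉ K → v ∉ K → ρ u = ρ v → μ u = μ v) (ht : Fintype.card V ≤ t + 1)
    {u v : V} (hu : u ∉ K) (hv : v ∉ K) :
    ocrIter G μ t u = ocrIter G μ t v ↔ ρ u = ρ v := by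
  refine ⟨fun h => hμρ u v (eq_of_ocrIter_eq h), fun huv => ?_⟩
  -- glue `ρ* := ocrIter G μ t` on `K` with `ρ` on `Kᶜ`
  set ρs : V → ℕ := ocrIter G μ t with hρs
  have hρs_eq : IsEquitable G ρs := isEquitable_ocrIter μ ht
  have hρs_ρ : ∀ a b, ρs a = ρs b → ρ a = ρ b := fun a b h => hμρ a b (eq_of_ocrIter_eq h)
  have hKs : IsSection G ρs K := isSection_of_finer hK hρs_ρ
  have hglue : IsEquitable G (fun x => if x ∈ K then (Sum.inl (ρs x) : ℕ ⊕ κ) else Sum.inr (ρ x)) := by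
    refine isEquitable_glue K (fun a b ha hb hab y => count_eq_inside hρs_eq hKs ha hb hab y)
      (fun a b ha hb hab y => ?_) (fun a a' w w' ha ha' hw hw' haa' hww' => ?_)
    · have := count_eq_inside (K := Kᶜ) hρ hK.compl ha hb hab y
      simpa only [Set.mem_compl_iff] using this
    · exact hK (hρs_ρ a a' haa') hww' (iff_of_true ha ha') (iff_of_false hw hw') fun h => hw (h.1 ha)
  -- the glued colouring is finer than `μ`, hence finer than `ρ*`
  have hfin : ∀ a b : V, (fun x => if x ∈ K then (Sum.inl (ρs x) : ℕ ⊕ κ) else Sum.inr (ρ x)) a =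
      (fun x => if x ∈ K then (Sum.inl (ρs x) : ℕ ⊕ κ) else Sum.inr (ρ x)) b → μ a = μ b := by
    intro a b hab
    by_cases ha : a ∈ K <;> by_cases hb : b ∈ K <;> simp [ha, hb] at hab
    · exact eq_of_ocrIter_eq hab
    · exact hout a b ha hb hab
  have := hglue.ocrIter_eq_of_finer hfin t (u := u) (v := v) (by simp [hu, hv, huv])
  exact this

omit [DecidableEq κ] in
/-- **Locality, inside part** (PER-PATH.md Lemma 2): with `K` a section of `ρ`, `μ` finer than `ρ`, `|V| ≤ t + 1` and
`|K| ≤ t + 1` (equitability of `ρ` is not even needed), inside `K` the coarsest equitable refinement of `μ` on `G`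
induces the same partition as colour refinement run on the INDUCED subgraph `G.induce K` from `μ|_K`: a sectioned
part may be refined on its own. -/
theorem ocrIter_restrict_iff (hK : IsSection G ρ K) (hμρ : ∀ u v, μ u = μ v → ρ u = ρ v)
    (ht : Fintype.card V ≤ t + 1) (htK : Fintype.card K ≤ t + 1) {u v : V} (hu : u ∈ K) (hv : v ∈ K) :
    ocrIter G μ t u = ocrIter G μ t v ↔
      ocrIter (G.induce K) (fun x : K => μ x) t ⟨u, hu⟩ = ocrIter (G.induce K) (fun x : K => μ x) t ⟨v, hv⟩ := by
  set ρs : V → ℕ := ocrIter G μ t with hρs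
  set τ : K → ℕ := ocrIter (G.induce K) (fun x : K => μ x) t with hτ
  have hρs_eq : IsEquitable G ρs := isEquitable_ocrIter μ ht
  have hρs_ρ : ∀ a b, ρs a = ρs b → ρ a = ρ b := fun a b h => hμρ a b (eq_of_ocrIter_eq h)
  have hKs : IsSection G ρs K := isSection_of_finer hK hρs_ρ
  have hτ_eq : IsEquitable (G.induce K) τ := isEquitable_ocrIter (G := G.induce K) _ htK
  have hτ_μ : ∀ a b : K, τ a = τ b → μ a = μ b := fun a b h => eq_of_ocrIter_eq (G := G.induce K) h
  constructor
  · -- `ρ*|_K` is equitable on `G.induce K` and finer than `μ|_K`, hence finer than `τ`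
    intro h
    have hind : IsEquitable (G.induce K) (fun x : K => ρs x) :=
      (isEquitable_induce_iff (G := G) K ρs).2 fun a b ha hb hab y => count_eq_inside hρs_eq hKs ha hb hab y
    exact hind.ocrIter_eq_of_finer (G := G.induce K) (fun a b hab => eq_of_ocrIter_eq (G := G) hab) t
      (u := ⟨u, hu⟩) (v := ⟨v, hv⟩) h
  · -- glue `τ` (extended by `0` outside) on `K` with `ρ*` on `Kᶜ`: equitable and finer than `μ`, hence finer than `ρ*`
    intro h
    classical
    let τ' : V → ℕ := fun x => if hx : x ∈ K then τ ⟨x, hx⟩ else 0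
    have hτ'K : ∀ (x : V) (hx : x ∈ K), τ' x = τ ⟨x, hx⟩ := fun x hx => by simp [τ', hx]
    have hglue : IsEquitable G (fun x => if x ∈ K then (Sum.inl (τ' x) : ℕ ⊕ ℕ) else Sum.inr (ρs x)) := by
      refine isEquitable_glue K (fun a b ha hb hab y => ?_) (fun a b ha hb hab y => ?_)
        (fun a a' w w' ha ha' hw hw' haa' hww' => ?_)
      · -- inside: the counts of `τ` on the induced subgraph
        rw [hτ'K a ha, hτ'K b hb] at hab
        have hcnt := (isEquitable_induce_iff (G := G) K τ').1 ?_ a b ha hb (by rw [hτ'K a ha, hτ'K b hb]; exact hab) y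
        · exact hcnt
        · -- `τ'|_K = τ` is equitable on `G.induce K`
          have : (fun x : K => τ' x) = τ := funext fun x => hτ'K x x.2
          rw [this]; exact hτ_eq
      · have := count_eq_inside (K := Kᶜ) hρs_eq hKs.compl ha hb hab y
        simpa only [Set.mem_compl_iff] using this
      · rw [hτ'K a ha, hτ'K a' ha'] at haa'
        have hρaa' : ρ a = ρ a' := hμρ a a' (hτ_μ _ _ haa')
        exact hK hρaa' (hρs_ρ w w' hww') (iff_of_true ha ha') (iff_of_false hw hw') fun h => hw (h.1 ha)
    have hfin : ∀ a b : V, (fun x => if x ∈ K then (Sum.inl (τ' x) : ℕ ⊕ ℕ) else Sum.inr (ρs x)) a =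
        (fun x => if x ∈ K then (Sum.inl (τ' x) : ℕ ⊕ ℕ) else Sum.inr (ρs x)) b → μ a = μ b := by
      intro a b hab
      by_cases ha : a ∈ K <;> by_cases hb : b ∈ K <;> simp [ha, hb] at hab
      · rw [hτ'K a ha, hτ'K b hb] at hab
        exact hτ_μ _ _ hab
      · exact eq_of_ocrIter_eq hab
    exact hglue.ocrIter_eq_of_finer hfin t (u := u) (v := v) (by simp [hu, hv, hτ'K u hu, hτ'K v hv, h])

end Locality

end PerPath

end Summit.PneNP.PneNP.Theorems
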